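import Summits.AtomisticToContinuum.BoseEinsteinCondensation.Theorems.BECCutLineWeakDisorderTaggedShiftDefs
import HarnessLib

/-!
# Route `BECCutLineWeakDisorder`, crux `TwoReplicaTransienceBound` (stmt-AtomisticToContinuum-9687),
# line `tagged-shift-log-harnack`: the block reduction
# (registered bookkeeping stub `stub_flatnessOfBlockParticipation`)

Support file (`--supports stmt-AtomisticToContinuum-9687`; proves the registered bookkeeping stub
`stub_flatnessOfBlockParticipation : Goal.stub_flatnessOfBlockParticipation`, i.e.
`BlockParticipationBornMoment → KineticScaleFlatnessBeyond`, of
`Theorems/BECCutLineWeakDisorderTaggedShiftDefs.lean`).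

The content is DETERMINISTIC and slice by slice: for a slice `g ≥ 0` (measurable, bounded,
vanishing off the box `Λ_L`) and any dyadic level `K`, with `a_Q = ∫_Q g` (`blockMass`),
`m_Q = ∫_Q g²` (`blockSqMass`), `S = Σ_Q a_Q²` (`levelSq`), `c = ℓ_K³`, `P_Q = c m_Q/a_Q²`
(`blockParticipation`) and `r̄_K = c (∫g²)/S` (`uvParticipation`),

  `(∫ g²) · r̄_K² ≤ Σ_Q m_Q P_Q²`                                    (`lintegral_sq_mul_uvParticipation_sq_le`)

by two finite Cauchy–Schwarz steps (`(Σ m_Q)² ≤ S · Σ m_Q²/a_Q²` and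
`(Σ m_Q P_Q)² ≤ (Σ m_Q)(Σ m_Q P_Q²)`) and the covering `∫ g² ≤ Σ_Q m_Q`; the `ℝ≥0∞` junk cases
(`∫ g = ∞ ⇒ S = ∞ ⇒ r̄_K = 0`; `a_Q = 0 ⇒ m_Q = 0`) are handled first. Integrating in the bath
variable `Y` (`lintegral_mono`) and threading the common quantifier prefix gives the stub.
-/

noncomputable section

open MeasureTheory Filter Set Finset
open scoped ENNReal NNReal Topology BigOperators

namespace Summit.AtomisticToContinuum.BoseEinsteinCondensation.Cruxes.TwoReplicaTransienceBound.TaggedShiftLogHarnack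

open Literature.MathematicalPhysics.QuantumManyBody.BoseGas
open Summit.AtomisticToContinuum.BoseEinsteinCondensation.Theses.BECCutLineWeakDisorder
open Summit.AtomisticToContinuum.BoseEinsteinCondensation.Cruxes.LandscapeBound.SiblingTelescopingChaining

/-! ### The finite-dimensional core: harmonic mean vs. quadratic mean -/

/-- **Real core** of the block reduction: for reals `α_i` and nonnegative reals `μ_i, γ` with
`α_i = 0 ⇒ μ_i = 0`, `(Σ μ) · (γ (Σ μ)/(Σ α²))² ≤ Σ_i μ_i (γ μ_i/α_i²)²` — two Cauchy–Schwarz steps: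
`(Σ μ_i)² = (Σ α_i · μ_i/α_i)² ≤ (Σ α_i²)(Σ μ_i²/α_i²)` and
`(Σ μ_i P_i)² ≤ (Σ μ_i)(Σ μ_i P_i²)` with `P_i = γ μ_i/α_i²`. [folklore] -/
theorem sum_mul_sq_div_sum_sq_le_real {ι : Type*} (s : Finset ι) {α μ : ι → ℝ} {γ : ℝ}
    (hμ : ∀ i ∈ s, 0 ≤ μ i) (hγ : 0 ≤ γ) (h0 : ∀ i ∈ s, α i = 0 → μ i = 0) :
    (∑ i ∈ s, μ i) * (γ * (∑ i ∈ s, μ i) / ∑ i ∈ s, α i ^ 2) ^ 2 ≤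
      ∑ i ∈ s, μ i * (γ * μ i / α i ^ 2) ^ 2 := by
  set M : ℝ := ∑ i ∈ s, μ i with hMdef
  set S : ℝ := ∑ i ∈ s, α i ^ 2 with hSdef
  set P : ι → ℝ := fun i => γ * μ i / α i ^ 2 with hPdef
  set U : ℝ := ∑ i ∈ s, μ i * P i with hUdef
  set V : ℝ := ∑ i ∈ s, μ i * P i ^ 2 with hVdef
  have hM : 0 ≤ M := sum_nonneg hμ
  have hS : 0 ≤ S := sum_nonneg fun i _ => sq_nonneg _
  have hP : ∀ i ∈ s, 0 ≤ P i := fun i hi =>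
    div_nonneg (mul_nonneg hγ (hμ i hi)) (sq_nonneg _)
  have hU : 0 ≤ U := sum_nonneg fun i hi => mul_nonneg (hμ i hi) (hP i hi)
  have hV : 0 ≤ V := sum_nonneg fun i hi => mul_nonneg (hμ i hi) (sq_nonneg _)
  -- first Cauchy–Schwarz: `M² ≤ S · Σ (μ/α)²`
  have hCS1 : M ^ 2 ≤ S * ∑ i ∈ s, (μ i / α i) ^ 2 := by
    have h := sum_mul_sq_le_sq_mul_sq s α (fun i => μ i / α i)
    have hsum : ∑ i ∈ s, α i * (μ i / α i) = M := by
      refine Finset.sum_congr rfl fun i hi => ?_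
      rcases eq_or_ne (α i) 0 with h0i | h0i
      · rw [h0i, h0 i hi h0i]; simp
      · exact mul_div_cancel₀ _ h0i
    rwa [hsum] at h
  have hγT : γ * ∑ i ∈ s, (μ i / α i) ^ 2 = U := by
    rw [hUdef, Finset.mul_sum]
    refine Finset.sum_congr rfl fun i _ => ?_
    simp only [hPdef]
    ring
  -- second Cauchy–Schwarz: `U² ≤ M V`
  have hCS2 : U ^ 2 ≤ M * V :=
    sum_sq_le_sum_mul_sum_of_sq_le_mul s hμ (fun i hi => mul_nonneg (hμ i hi) (sq_nonneg _))
      fun i _ => le_of_eq (by ring)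
  change M * (γ * M / S) ^ 2 ≤ V
  rcases hS.eq_or_lt with hS0 | hSpos
  · rw [← hS0, div_zero]; simpa using hV
  rcases hM.eq_or_lt with hM0 | hMpos
  · rw [← hM0, zero_mul]; exact hV
  have h1 : γ * M ^ 2 / S ≤ U := by
    rw [div_le_iff₀ hSpos, ← hγT]
    calc γ * M ^ 2 ≤ γ * (S * ∑ i ∈ s, (μ i / α i) ^ 2) := by gcongr
      _ = (γ * ∑ i ∈ s, (μ i / α i) ^ 2) * S := by ring
  have h2 : (γ * M ^ 2 / S) ^ 2 ≤ M * V :=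
    (pow_le_pow_left₀ (by positivity) h1 2).trans hCS2
  have h3 : M * (γ * M / S) ^ 2 = (γ * M ^ 2 / S) ^ 2 / M := by
    field_simp
  rw [h3, div_le_iff₀ hMpos]
  linarith [mul_comm M V]

/-- The same inequality in `ℝ≥0` (coercion of `sum_mul_sq_div_sum_sq_le_real`). [folklore] -/
theorem sum_mul_sq_div_sum_sq_le_nnreal {ι : Type*} [Fintype ι] (α μ : ι → ℝ≥0) (γ : ℝ≥0)
    (h0 : ∀ i, α i = 0 → μ i = 0) :
    (∑ i, μ i) * (γ * (∑ i, μ i) / ∑ i, α i ^ 2) ^ 2 ≤ ∑ i, μ i * (γ * μ i / α i ^ 2) ^ 2 := by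
  have h := sum_mul_sq_div_sum_sq_le_real Finset.univ (α := fun i => (α i : ℝ))
    (μ := fun i => (μ i : ℝ)) (γ := (γ : ℝ)) (fun i _ => (μ i).2) γ.2
    (fun i _ h => NNReal.coe_eq_zero.2 (h0 i (NNReal.coe_eq_zero.1 h)))
  exact_mod_cast h

/-- The same inequality in `ℝ≥0∞` for FINITE data (`a_i, m_i, c < ∞`, `a_i = 0 ⇒ m_i = 0`; the
`ℝ≥0∞` conventions `x/0 = ∞` (`x ≠ 0`), `0/0 = 0` then never bite). [folklore] -/
theorem sum_mul_sq_div_sum_sq_le {ι : Type*} [Fintype ι] {a m : ι → ℝ≥0∞} {c : ℝ≥0∞}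
    (hc : c ≠ ⊤) (ha : ∀ i, a i ≠ ⊤) (hm : ∀ i, m i ≠ ⊤) (h0 : ∀ i, a i = 0 → m i = 0) :
    (∑ i, m i) * (c * (∑ i, m i) / ∑ i, a i ^ 2) ^ 2 ≤ ∑ i, m i * (c * m i / a i ^ 2) ^ 2 := by
  lift a to ι → ℝ≥0 using ha
  lift m to ι → ℝ≥0 using hm
  lift c to ℝ≥0 using hc
  have h0' : ∀ i, a i = 0 → m i = 0 := fun i hi => by
    have := h0 i (by simp [hi])
    simpa using this
  -- right-hand side, summand by summand
  have hR : ∀ i, ((m i : ℝ≥0∞)) * ((c : ℝ≥0∞) * (m i : ℝ≥0∞) / (a i : ℝ≥0∞) ^ 2) ^ 2 =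
      ((m i * (c * m i / a i ^ 2) ^ 2 : ℝ≥0) : ℝ≥0∞) := by
    intro i
    rcases eq_or_ne (a i) 0 with hai | hai
    · simp [hai, h0' i hai]
    · rw [ENNReal.coe_mul, ENNReal.coe_pow, ENNReal.coe_div (pow_ne_zero 2 hai), ENNReal.coe_mul,
        ENNReal.coe_pow]
  have hRsum : ∑ i, ((m i : ℝ≥0∞)) * ((c : ℝ≥0∞) * (m i : ℝ≥0∞) / (a i : ℝ≥0∞) ^ 2) ^ 2 =
      ((∑ i, m i * (c * m i / a i ^ 2) ^ 2 : ℝ≥0) : ℝ≥0∞) := by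
    rw [ENNReal.ofNNReal_finsetSum]
    exact Finset.sum_congr rfl fun i _ => hR i
  -- left-hand side
  rcases eq_or_ne (∑ i, a i ^ 2) 0 with hS | hS
  · have hm0 : ∀ i, m i = 0 := fun i =>
      h0' i (pow_eq_zero_iff two_ne_zero |>.1 ((Finset.sum_eq_zero_iff.1 hS) i (mem_univ _)))
    simp [hm0]
  have hL : (∑ i, (m i : ℝ≥0∞)) * ((c : ℝ≥0∞) * (∑ i, (m i : ℝ≥0∞)) / ∑ i, (a i : ℝ≥0∞) ^ 2) ^ 2 =
      (((∑ i, m i) * (c * (∑ i, m i) / ∑ i, a i ^ 2) ^ 2 : ℝ≥0) : ℝ≥0∞) := by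
    rw [ENNReal.coe_mul, ENNReal.coe_pow, ENNReal.coe_div hS, ENNReal.coe_mul]
    push_cast
    rfl
  beta_reduce
  rw [hRsum, hL]
  exact ENNReal.coe_le_coe.2 (sum_mul_sq_div_sum_sq_le_nnreal a m c h0')

/-! ### The block reduction, slice by slice -/

/-- `m_Q ≤ M · a_Q` for `g ≤ M`. [folklore] -/
theorem blockSqMass_le_mul_blockMass {g : Space → ℝ≥0∞} (hg : Measurable g) {M : ℝ≥0∞}
    (hgM : ∀ x, g x ≤ M) (L : ℝ) (j : ℕ) (i : Fin 3 → Fin (2 ^ j)) :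
    blockSqMass g L j i ≤ M * blockMass g L j i := by
  unfold blockSqMass blockMass
  calc ∫⁻ x in dyadicCube L j i, g x ^ 2 = ∫⁻ x in dyadicCube L j i, g x * g x :=
        lintegral_congr fun x => sq (g x)
    _ ≤ ∫⁻ x in dyadicCube L j i, M * g x := lintegral_mono fun x => mul_le_mul' (hgM x) le_rfl
    _ = M * ∫⁻ x in dyadicCube L j i, g x := lintegral_const_mul _ hg

/-- **The within-block Cauchy–Schwarz reduction** (pointwise in the bath variable): for `g ≥ 0`
measurable, bounded, vanishing off `Λ_L` (`L > 0`) and every level `K`,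
`(∫ g²) · r̄_K² ≤ Σ_Q m_Q P_Q²` — the `a_Q²`-weighted harmonic mean `r̄_K` of the within-block
participations `P_Q` is at most their `m_Q`-weighted quadratic mean. [folklore] -/
theorem lintegral_sq_mul_uvParticipation_sq_le {g : Space → ℝ≥0∞} (hg : Measurable g) {L : ℝ}
    (hL : 0 < L) (h0 : ∀ x, x ∉ box L → g x = 0) {M : ℝ≥0∞} (hM : M ≠ ⊤) (hgM : ∀ x, g x ≤ M)
    (K : ℕ) :
    (∫⁻ x, g x ^ 2) * uvParticipation g L K ^ 2 ≤
      ∑ i : Fin 3 → Fin (2 ^ K), blockSqMass g L K i * blockParticipation g L K i ^ 2 := by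
  have hmi : ∀ i, blockSqMass g L K i ≤ M * blockMass g L K i :=
    blockSqMass_le_mul_blockMass hg hgM L K
  -- covering: `∫ g² ≤ Σ_Q m_Q`
  have hcover : ∫⁻ x, g x ^ 2 ≤ ∑ i : Fin 3 → Fin (2 ^ K), blockSqMass g L K i :=
    lintegral_le_sum_blockMass (g := fun x => g x ^ 2) hL (fun x hx => by simp [h0 x hx]) K
  -- junk case: infinite mass forces an infinite block mass, `S_K = ∞`, `r̄_K = 0`
  by_cases hs : ∫⁻ x, g x = ⊤
  · have hS : levelSq g L K = ⊤ := by
      have h := lintegral_le_sum_blockMass hL h0 K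
      rw [hs, top_le_iff] at h
      obtain ⟨i, -, hi⟩ := ENNReal.sum_eq_top.1 h
      unfold levelSq
      exact ENNReal.sum_eq_top.2 ⟨i, mem_univ _, by rw [hi]; simp⟩
    rw [uvParticipation, hS, ENNReal.div_top]
    simp
  -- finite case
  have ha : ∀ i, blockMass g L K i ≠ ⊤ := fun i =>
    ne_top_of_le_ne_top hs (blockMass_le_lintegral g L K i)
  have hm : ∀ i, blockSqMass g L K i ≠ ⊤ := fun i =>
    ne_top_of_le_ne_top (ENNReal.mul_ne_top hM (ha i)) (hmi i)
  have h00 : ∀ i, blockMass g L K i = 0 → blockSqMass g L K i = 0 := fun i h => by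
    have := hmi i
    rw [h, mul_zero] at this
    exact nonpos_iff_eq_zero.1 this
  unfold uvParticipation levelSq blockParticipation
  calc (∫⁻ x, g x ^ 2) * (ENNReal.ofReal ((L / 2 ^ K) ^ 3) * (∫⁻ x, g x ^ 2) /
          ∑ i : Fin 3 → Fin (2 ^ K), blockMass g L K i ^ 2) ^ 2
      ≤ (∑ i : Fin 3 → Fin (2 ^ K), blockSqMass g L K i) *
          (ENNReal.ofReal ((L / 2 ^ K) ^ 3) * (∑ i : Fin 3 → Fin (2 ^ K), blockSqMass g L K i) /
            ∑ i : Fin 3 → Fin (2 ^ K), blockMass g L K i ^ 2) ^ 2 := by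
        gcongr
    _ ≤ _ := sum_mul_sq_div_sum_sq_le ENNReal.ofReal_ne_top ha hm h00

/-! ### The registered stub -/

/-- PROVED bookkeeping stub `stub_flatnessOfBlockParticipation`:
**`BlockParticipationBornMoment → KineticScaleFlatnessBeyond`** — slice by slice
`m(Y) r̄_K(g_Y)² ≤ Σ_Q m_Q(g_Y) P_Q(g_Y)²` (`lintegral_sq_mul_uvParticipation_sq_le` on the slices
`g_Y = |Ψ_T(·,Y)|`, bounded by `1/√𝒩` and vanishing off the box), integrated in `Y`, with the
identical quantifier prefix (same `κ₀, A, ρ₀, C`). -/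
theorem stub_flatnessOfBlockParticipation : Goal.stub_flatnessOfBlockParticipation := by
  intro hB v hv
  obtain ⟨κ₀, hκ₀, A, hA, H⟩ := hB v hv
  refine ⟨κ₀, hκ₀, A, hA, fun κ hκ hκle => ?_⟩
  obtain ⟨ρ₀, hρ₀, H1⟩ := H κ hκ hκle
  refine ⟨ρ₀, hρ₀, fun ρ hρ hρlt => ?_⟩
  obtain ⟨C, hC, ev⟩ := H1 ρ hρ hρlt
  refine ⟨C, hC, ?_⟩
  filter_upwards [ev] with n hn T hT
  refine le_trans (lintegral_mono fun Y => ?_) (hn T hT)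
  have hT0 : 0 ≤ T := le_trans (by positivity) hT
  set L : ℝ := sideLength ρ (n + 1) with hLdef
  have hLpos : 0 < L := Real.rpow_pos_of_pos (div_pos (Nat.cast_pos.mpr n.succ_pos) hρ) _
  set Ψ : Config (n + 1) → ℝ := fkWitness (N := n + 1) v L T (fun _ => (1 : ℝ≥0∞)) with hΨdef
  have hΨm : Measurable Ψ := measurable_fkWitness hv.1 L T measurable_const
  have hbound : ∀ x, slice Ψ Y x ≤
      ENNReal.ofReal (1 / Real.sqrt (fkNormSq (N := n + 1) v L T (fun _ => (1 : ℝ≥0∞))).toReal) :=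
    fun x => by
      show ((‖Ψ (Matrix.vecCons x Y)‖₊ : ℝ≥0∞)) ≤ _
      rw [coe_nnnorm_fkWitness]
      exact ENNReal.ofReal_le_ofReal (fkWitness_one_le_inv_sqrt v L T _)
  exact lintegral_sq_mul_uvParticipation_sq_le (measurable_slice hΨm Y) hLpos
    (fun x hx => slice_fkWitness_eq_zero v hT0 _ Y hx) ENNReal.ofReal_ne_top hbound _

end Summit.AtomisticToContinuum.BoseEinsteinCondensation.Cruxes.TwoReplicaTransienceBound.TaggedShiftLogHarnack

end
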